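import Mathlib
import Literature.MathematicalPhysics.StatisticalMechanics.BarlowStacking
import Literature.MathematicalPhysics.StatisticalMechanics.Crystallization

/-!
# Definitions for the crux `GappedShellCensus.CleanLimitsHaveWindows` (stmt-AtomisticToContinuum-15932), line `Sketch`

Objects posited by the line (lead prover-line-stmt-AtomisticToContinuum-15932-c1-0), used in the registered
stubs `stub_coercivity`, `stub_closing`, `stub_defectFreeRigid` of the skeleton `Lines/Sketch.lean`:

* `bondShell a Z p` — the bond shell of a site: the points of `Z` other than `p` within `a(1 + 1/50)` of `p`;
* `siteEnergy Z p` — the Lennard-Jones site energy `Σ'_{q ∈ Z, q ≠ p} V_LJ(|p − q|)` (the summand shape of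
  the window bounds (U)/(L), `LayeredHull.stub_windowBounds`);
* `slotC a' h⁺ h⁻`, `slotH a' h⁺ h⁻` — the twelve neighbour offsets of a site of an EXACTLY LAYERED set
  (triangular layers of spacing `a'`, registry offsets `±w`, FREE heights `h⁺` above and `h⁻` below): cubic type
  (staggered triangles, cuboctahedral combinatorics) and hexagonal type (eclipsed triangles, anticuboctahedral);
* `clusterMisfit p q slot` — squared distance-data misfit between a labelled 12-cluster `q : Fin 12 → ℝ³`
  about `p` and a slot model (radial distances and all mutual distances), zero iff the 13-point clusters are
  congruent;
* `localDefect a Z p` — the TRANSVERSAL DEFECT of `Z` at `p`: the infimum, over labellings of the bond shell by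
  `Fin 12`, over the two types and over parameters `(a', h⁺, h⁻)` in the box `[a/2, 2a] × [0, 2a]²`, of the
  cluster misfit. It vanishes exactly when the bond shell of `p` is congruent to the shell of a site of some
  exactly layered set (any in-plane spacing, any two heights, either type) — the family on which the proved
  `LayeredHull.PeriodicGivenLayered_proof` (stmt-11779) operates — and it is a continuous function of the
  cluster, so that it transfers along uniform recurrence.

No facts are asserted here.
-/

noncomputable section

namespace Summit.AtomisticToContinuum.Crystallization.Theorems.CleanHull

open Literature.MathematicalPhysics.StatisticalMechanics

/-- The bond shell of `p` in `Z` at scale `a`: the points of `Z` other than `p` within `a(1 + 1/50)`.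
[folklore] -/
def bondShell (a : ℝ) (Z : Set (EuclideanSpace ℝ (Fin 3))) (p : EuclideanSpace ℝ (Fin 3)) :
    Set (EuclideanSpace ℝ (Fin 3)) :=
  {w ∈ Z | w ≠ p ∧ dist p w ≤ a * (1 + 1 / 50)}

/-- The Lennard-Jones site energy of `p` in the (infinite) configuration `Z`:
`Σ'_{q ∈ Z, q ≠ p} V_LJ(dist p q)` (a `tsum`; absolutely convergent for uniformly discrete `Z`). [folklore] -/
def siteEnergy (Z : Set (EuclideanSpace ℝ (Fin 3))) (p : EuclideanSpace ℝ (Fin 3)) : ℝ :=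
  ∑' q : {q : EuclideanSpace ℝ (Fin 3) // q ∈ Z ∧ q ≠ p}, lennardJones (dist p (q : EuclideanSpace ℝ (Fin 3)))

/-- Neighbour offsets of a site of an exactly layered set of CUBIC local type (letters `A → B → C`): six in-plane
neighbours `±u, ±v, ±(u − v)`, an upper triangle `h⁺e₃ + {w, w − u, w − v}` and the centrally symmetric lower
triangle `−h⁻e₃ − {w, w − u, w − v}` (`u, v` = `triangularVec₁/₂ a'`, `w = barlowOffset a'`). [folklore] -/
def slotC (a' hp hm : ℝ) : Fin 12 → EuclideanSpace ℝ (Fin 3) :=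
  ![triangularVec₁ a', -triangularVec₁ a', triangularVec₂ a', -triangularVec₂ a',
    triangularVec₁ a' - triangularVec₂ a', triangularVec₂ a' - triangularVec₁ a',
    hp • layerNormal 1 + barlowOffset a',
    hp • layerNormal 1 + barlowOffset a' - triangularVec₁ a',
    hp • layerNormal 1 + barlowOffset a' - triangularVec₂ a',
    -(hm • layerNormal 1) - barlowOffset a',
    -(hm • layerNormal 1) - barlowOffset a' + triangularVec₁ a',
    -(hm • layerNormal 1) - barlowOffset a' + triangularVec₂ a']

/-- Neighbour offsets of a site of an exactly layered set of HEXAGONAL local type (letters `A → B → A`): as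
`slotC` but with the lower triangle `−h⁻e₃ + {w, w − u, w − v}` eclipsed with the upper one. [folklore] -/
def slotH (a' hp hm : ℝ) : Fin 12 → EuclideanSpace ℝ (Fin 3) :=
  ![triangularVec₁ a', -triangularVec₁ a', triangularVec₂ a', -triangularVec₂ a',
    triangularVec₁ a' - triangularVec₂ a', triangularVec₂ a' - triangularVec₁ a',
    hp • layerNormal 1 + barlowOffset a',
    hp • layerNormal 1 + barlowOffset a' - triangularVec₁ a',
    hp • layerNormal 1 + barlowOffset a' - triangularVec₂ a',
    -(hm • layerNormal 1) + barlowOffset a',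
    -(hm • layerNormal 1) + barlowOffset a' - triangularVec₁ a',
    -(hm • layerNormal 1) + barlowOffset a' - triangularVec₂ a']

/-- Distance-data misfit between a labelled cluster `q : Fin 12 → ℝ³` about the centre `p` and a slot model:
squared deviations of the twelve radial distances and of all mutual distances. It vanishes iff the 13-point
clusters `{p} ∪ range q` and `{0} ∪ range slot` are congruent label by label. [folklore] -/
def clusterMisfit (p : EuclideanSpace ℝ (Fin 3)) (q slot : Fin 12 → EuclideanSpace ℝ (Fin 3)) : ℝ :=
  ∑ k : Fin 12, (dist (q k) p - ‖slot k‖) ^ 2 +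
    ∑ k : Fin 12, ∑ l : Fin 12, (dist (q k) (q l) - dist (slot k) (slot l)) ^ 2

/-- **The transversal defect** of `Z` at `p` (scale `a`): the infimum over labellings `e` of the bond shell of
`p` by `Fin 12`, over parameters `(a', h⁺, h⁻) ∈ [a/2, 2a] × [0, 2a] × [0, 2a]` and over the two local types,
of the cluster misfit against the exactly layered slot model. (If the bond shell does not have exactly twelve
points the labelling type is empty and the value is the junk `0`.) [folklore] -/
def localDefect (a : ℝ) (Z : Set (EuclideanSpace ℝ (Fin 3))) (p : EuclideanSpace ℝ (Fin 3)) : ℝ :=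
  ⨅ e : ↥(bondShell a Z p) ≃ Fin 12,
    ⨅ θ : {θ : ℝ × ℝ × ℝ // a / 2 ≤ θ.1 ∧ θ.1 ≤ 2 * a ∧ 0 ≤ θ.2.1 ∧ θ.2.1 ≤ 2 * a ∧ 0 ≤ θ.2.2 ∧ θ.2.2 ≤ 2 * a},
      min (clusterMisfit p (fun k => (e.symm k : EuclideanSpace ℝ (Fin 3))) (slotC θ.1.1 θ.1.2.1 θ.1.2.2))
        (clusterMisfit p (fun k => (e.symm k : EuclideanSpace ℝ (Fin 3))) (slotH θ.1.1 θ.1.2.1 θ.1.2.2))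

/-- The cluster misfit is non-negative. [folklore] -/
theorem clusterMisfit_nonneg (p : EuclideanSpace ℝ (Fin 3)) (q slot : Fin 12 → EuclideanSpace ℝ (Fin 3)) :
    0 ≤ clusterMisfit p q slot :=
  add_nonneg (Finset.sum_nonneg fun _ _ => sq_nonneg _)
    (Finset.sum_nonneg fun _ _ => Finset.sum_nonneg fun _ _ => sq_nonneg _)

/-- The transversal defect is non-negative. [folklore] -/
theorem localDefect_nonneg (a : ℝ) (Z : Set (EuclideanSpace ℝ (Fin 3))) (p : EuclideanSpace ℝ (Fin 3)) :
    0 ≤ localDefect a Z p :=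
  Real.iInf_nonneg fun _ => Real.iInf_nonneg fun _ =>
    le_min (clusterMisfit_nonneg _ _ _) (clusterMisfit_nonneg _ _ _)

end Summit.AtomisticToContinuum.Crystallization.Theorems.CleanHull

end
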